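import Mathlib
import HarnessLib
import Literature.AlgebraicGeometry.Ramification.InertiaNormalSylow
import Summits.ResolutionOfSingularities.ResolutionOfSingularities.Theorems.WildQuotientsWildQuotientResolutionPointMoveNoNpcCurvesRegular

/-!
# NPC points created by a point move on a regular threefold are closed and `κ(z)`-rational (crux `WildQuotients.WildQuotientResolution`)

Crux stmt-ResolutionOfSingularities-15640 (`WildQuotientResolution`), registered stub
`stub_phaseZeroHighDim`, move-game track (`…PointMove` p810587). Final form of memo
`PHASE0-DIM3-TERMINATION.md` §1 / addendum v2 (R1): combining
✓`hasNormalSylow_inertia_of_pointBlowup_regular_three` (a point over the blown-up closed point `z`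
with `κ(z) → κ(x)` not onto is p-closed) with the Jacobson-scheme characterisation of closed points
(Mathlib `isClosed_singleton_iff_locallyOfFiniteType`: on a Jacobson scheme, `x` is closed iff
`Spec κ(x) → X` is locally of finite type): if `κ(z) → κ(x)` is onto (hence an isomorphism) and
`z` is closed, then `Spec κ(x) → X♯ → X′` is `Spec κ(z) → X′` up to isomorphism, locally of finite
type, so `Spec κ(x) → X♯` is (`locallyOfFiniteType_of_comp`) and `x` is CLOSED. Hence: **every
point of non-p-closed inertia created by an equivariant point move on a regular threefold is a
closed, `κ(z)`-rational point of the exceptional divisor** — no NPC curves (addendum v2, (S4)/(R1)).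

* `isClosed_singleton_of_surjective_residueFieldMap` — closed image + residue isomorphism ⇒ closed
  (Jacobson schemes, `f` locally of finite type).
* `isClosed_and_surjective_of_not_hasNormalSylow_inertia` — the NPC statement.

[OURS · crux stmt-ResolutionOfSingularities-15640 · helper toward `stub_phaseZeroHighDim`
(threefold Phase 0); folklore, counted 0; AI-level work, weaker than expert review.]
-/

-- single-problem summit: the doubled namespace component `ResolutionOfSingularities` is forced
set_option linter.dupNamespace false

namespace Summit.ResolutionOfSingularities.ResolutionOfSingularities.Theorems.WildQuotientResolution.PointMoveNoNpcCurves

open CategoryTheory AlgebraicGeometry TopologicalSpace IsLocalRing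
open Literature.AlgebraicGeometry.Resolution Literature.AlgebraicGeometry.Ramification

/-- **A point with closed image and no residue field extension is closed** (Jacobson schemes).
Let `f : X → Y` be locally of finite type between Jacobson schemes, `x ∈ X` with `f x` closed and
`κ(f x) → κ(x)` surjective. Then `x` is closed: `Spec κ(x) → X → Y` factors as the isomorphism
`Spec κ(x) ≅ Spec κ(f x)` followed by `Spec κ(f x) → Y`, which is locally of finite type since
`f x` is closed (`isClosed_singleton_iff_locallyOfFiniteType`); so `Spec κ(x) → X` is locally of
finite type (`locallyOfFiniteType_of_comp`) and `x` is closed. [folklore; StacksProject 01TB] -/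
theorem isClosed_singleton_of_surjective_residueFieldMap {X Y : Scheme.{0}} (f : X ⟶ Y)
    [LocallyOfFiniteType f] [JacobsonSpace X] [JacobsonSpace Y] (x : X)
    (hz : IsClosed ({f.base x} : Set Y))
    (hsurj : Function.Surjective (f.residueFieldMap x).hom) : IsClosed ({x} : Set X) := by
  -- the residue field map is an isomorphism
  have hbij : Function.Bijective (f.residueFieldMap x).hom :=
    ⟨(f.residueFieldMap x).hom.injective, hsurj⟩
  haveI : IsIso (f.residueFieldMap x) := by
    have e : IsIso (RingEquiv.ofBijective (f.residueFieldMap x).hom hbij).toCommRingCatIso.hom :=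
      inferInstance
    exact e
  -- `Spec κ(z) → Y` is locally of finite type since `z = f x` is closed
  haveI : LocallyOfFiniteType (Y.fromSpecResidueField (f.base x)) :=
    isClosed_singleton_iff_locallyOfFiniteType.mp hz
  have hcomp : LocallyOfFiniteType (X.fromSpecResidueField x ≫ f) := by
    rw [← Scheme.Hom.SpecMap_residueFieldMap_fromSpecResidueField]
    infer_instance
  haveI := hcomp
  haveI : LocallyOfFiniteType (X.fromSpecResidueField x) :=
    locallyOfFiniteType_of_comp (X.fromSpecResidueField x) f
  exact isClosed_singleton_iff_locallyOfFiniteType.mpr inferInstance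

/-- **NPC points created by a point move on a regular threefold are closed and
`κ(z)`-rational.** In the setting of ✓`hasNormalSylow_inertia_of_pointBlowup_regular_three`
(equivariant blow-up `π` of the finite stable set `Z` of closed points of the integral locally
Noetherian `X′`, `x` over `z ∈ Z`, `𝒪_{X′,z}` regular of dimension `3`, residue characteristics
`p`), on Jacobson schemes (e.g. everything locally of finite type over a field): if the inertia
group `I_x` is NOT p-closed, then `κ(z) → κ(x)` is onto and `x` is a CLOSED point. So the
non-p-closed locus over the centre of a point move consists of `κ(z)`-rational closed points of the
exceptional divisors — point moves create no NPC curves (memo §1, (S4)/(R1)). [folklore] -/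
theorem isClosed_and_surjective_of_not_hasNormalSylow_inertia (p : ℕ) [Fact p.Prime]
    {X' X₁ : Scheme.{0}} (q : X' ⟶ X₁) [IsAffineHom q]
    {G : Type} [Group G] [Finite G] (ρ : G →* Aut X') (hfaith : Function.Injective ρ)
    (hρ : ∀ g : G, (ρ g).hom ≫ q = q) [IsIntegral X'] [IsLocallyNoetherian X']
    [JacobsonSpace X']
    {Z : Set X'} (hZc : IsClosed Z) (hZf : Z.Finite) (hZpt : ∀ z ∈ Z, IsClosed ({z} : Set X'))
    {Xs : Scheme.{0}} {π : Xs ⟶ X'}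
    (hπ : IsBlowup π (Scheme.IdealSheafData.vanishingIdeal ⟨Z, hZc⟩)) [IsIntegral Xs]
    [JacobsonSpace Xs]
    (ρs : G →* Aut Xs) (hequiv : ∀ g : G, (ρs g).hom ≫ π = π ≫ (ρ g).hom)
    (x : Xs) (hx : π.base x ∈ Z)
    [CharP (ResidueField (X'.presheaf.stalk (π.base x))) p]
    [CharP (ResidueField (Xs.presheaf.stalk x)) p]
    [IsRegularLocalRing (X'.presheaf.stalk (π.base x))]
    (hdim3 : ringKrullDim (X'.presheaf.stalk (π.base x)) = (3 : ℕ))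
    (hnpc : ¬ HasNormalSylow p (inertiaSubgroup ρs x)) :
    IsClosed ({x} : Set Xs) ∧ Function.Surjective (ResidueField.map (π.stalkMap x).hom) := by
  have hsurj : Function.Surjective (ResidueField.map (π.stalkMap x).hom) := by
    by_contra hκ
    exact hnpc (hasNormalSylow_inertia_of_pointBlowup_regular_three p q ρ hfaith hρ hZc hZf hZpt hπ
      ρs hequiv x hx hdim3 hκ)
  haveI : IsProper π := hπ.isProper
  refine ⟨isClosed_singleton_of_surjective_residueFieldMap π x (hZpt _ hx) ?_, hsurj⟩
  exact hsurj

end Summit.ResolutionOfSingularities.ResolutionOfSingularities.Theorems.WildQuotientResolution.PointMoveNoNpcCurves
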